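import Literature.Probability.RandomPlanarGeometry.SAWPulledLargeForceExpansionZdWordSearch
import Literature.Probability.RandomPlanarGeometry.SAWPulledLargeForceExpansionZdNineStep
import HarnessLib

/-!
# «ZD-TEN-STEP»: the first-occurrence symmetry, the reduced census read in every dimension, and `c₉(ℤ^d)`

Topic `Literature/Probability/RandomPlanarGeometry` (sequel of `…ZdWordSearch`, whose kernel cell `dfsV_eight_reduced` censused the
25 772 canonical self-avoiding eight-letter words WITH POSITIVE FIRST OCCURRENCES by closer class and number of axes, and of
`…ZdNineStep`, which assembled `c₈(ℤ^d)`).  Four steps.  (1) SIGN FLIPS BY AXIS (`flipW`): they keep first occurrences, ranks,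
canonicity and the number of axes, and normalising the first occurrences to be positive (`normW`) is `2^k`-to-one on the words with
`k` axes — ★★ `card_filter_eq_two_pow_mul_card`; the reduced letter policy of the search writes exactly the canonical words with positive
first occurrences — ★★ `rgA_alwR_iff`; hence ★★★ `card_eq_sum_dfsN_reduced`: a flip-invariant type-invariant count over `Word L d` is
`Σ_k 2^k n_k d^{(k)}` with `n_k` the REDUCED search counts.  (2) SEMANTICS of the search state: walking back along the reversed prefix
accumulates the coordinates of block sums (`foldl_addD_coords`, `vecL_take_reverse`), so ★★ `prefixOK_iff_blocks` (every prefix passes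
`okR` iff no block of steps vanishes — the word is self-avoiding) and ★★ `unitR_st_iff` (the last `j` letters are closed by one more
letter).  (3) THE FOUR CENSUSES at word length 8 in every dimension `d` (★★ `card_saw8` = `c₈(ℤ^d)` by a third route, ★★ `card_sq8`,
★★ `card_hx8`, ★★ `card_oct8`: the eight-letter self-avoiding words whose tail from position 5 / 3 / 1 is closed by one more letter),
from the tree cell via ★★ `search_iff_class` and the flip-invariance `sum_flipW_eq_zero_iff`.  (4) THE LAST LETTER of a nine-letter word
(★ `isSAW_snoc_iff8`, ★ `card_ext_add8`, ★★ `card_sawWords_nine_add`: `#SAW9 + #SAW8 + #Sq + #Hx + #Oct = 2d·#SAW8`) ⇒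
★★★ `count_nine_add : c₉(ℤ^d) + 2048d⁸ + 1600d⁶ + 15376d³ + 5858d = 512d⁹ + 2816d⁷ + 704d⁵ + 4096d⁴ + 16756d²` for every `d`
(`count_nine`; `d = 1, 2, 3`: 2, 16 268, 1 853 886 — Table C.1), and by `SAWIrreducibleBridgeSpanOne` ★★★ `costCoeffZd_nine_ten`:
the cost-nine irreducible bridges of length ten of the pulled self-avoiding walk on `ℤ^{d+1}` number `N_{9,10}(ℤ^{d+1}) = c₉(ℤ^d)` — the
first cell of the cost-nine column of the large-force expansion.  Attribution: the number of `n`-step self-avoiding walks of `ℤ^d` as a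
polynomial in `d` is classical print (Fisher–Gaunt 1964; [cite: ClisbyLiangSlade2007]); the value is re-derived here by the lane's type
census, and the cost reading `N_{9,10}` is the lane's (FINDING-PULLED-LARGE-FORCE (23)).  The definitions `flipW`, `FirstPos`, `axesOf`, `negAxes`, `normW`,
`vecL`, `coords`, `SAW8`, `tail8`, `TailClose`, `Cls8`, `nTab`, `snocEquiv8` are this file's tool notions (not notions in print).  No number is taken from print.
[cite: MadrasSlade1993, Appendix C, Table C.1]

Provenance: lane «pcv-sawmu», a-p3 g20 (2026-08-26); the census values agree with the seat's enumerators (`g20/search/types8.py`,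
`table8red.py`) and with lit-1 g27's independent desk census (INBOX 12:29:36Z).
-/

open Finset
open scoped BigOperators
open Literature.Probability.LatticeModels
open Literature.Probability.RandomPlanarGeometry.SAW

namespace Literature.Probability.RandomPlanarGeometry.SAW.Zd

namespace WordTypes

/-! ### Sign flips by axis: the first-occurrence symmetry

Flipping the signs of all letters on a set of axes preserves the axis pattern (first occurrences, ranks, canonicity, number of axes)
and every vanishing of block sums; normalising a word so that every FIRST occurrence is positive is a `2^k`-to-one map on the words
with `k` axes.  Hence a flip-invariant count over canonical words is `2^k` times the count over the canonical words with positive first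
occurrences — the words the reduced policy `alwR` generates (`rgA_alwR_iff`). -/

section flips

variable {L n : ℕ}

/-- Flip the signs of the letters whose axis lies in `S`. [cite: MadrasSlade1993, Definition 1.2.4] -/
def flipW (S : Finset (Fin n)) (u : Word L n) : Word L n := fun p => if (u p).1 ∈ S then ((u p).1, !(u p).2) else u p

/-- Flips keep axes. [cite: MadrasSlade1993, Definition 1.2.4] -/
theorem flipW_fst (S : Finset (Fin n)) (u : Word L n) (p : Fin L) : (flipW S u p).1 = (u p).1 := by
  unfold flipW; split_ifs <;> rfl

/-- The sign after a flip. [cite: MadrasSlade1993, Definition 1.2.4] -/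
theorem flipW_snd (S : Finset (Fin n)) (u : Word L n) (p : Fin L) :
    (flipW S u p).2 = if (u p).1 ∈ S then !(u p).2 else (u p).2 := by
  unfold flipW; split_ifs <;> rfl

/-- Flipping twice is the identity. [cite: MadrasSlade1993, Definition 1.2.4] -/
theorem flipW_flipW (S : Finset (Fin n)) (u : Word L n) : flipW S (flipW S u) = u := by
  funext p
  refine Prod.ext (by rw [flipW_fst, flipW_fst]) ?_
  rw [flipW_snd, flipW_fst, flipW_snd]
  split_ifs <;> simp

/-- `IsFirst` depends on the axes only. [cite: MadrasSlade1993, Definition 1.2.4] -/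
theorem isFirst_congr_fst {u u' : Word L n} (h : ∀ p, (u p).1 = (u' p).1) (p : Fin L) : IsFirst u p ↔ IsFirst u' p := by
  unfold IsFirst; simp only [h]

/-- `firsts` depends on the axes only. [cite: MadrasSlade1993, Definition 1.2.4] -/
theorem firsts_congr_fst {u u' : Word L n} (h : ∀ p, (u p).1 = (u' p).1) : firsts u = firsts u' := by
  unfold firsts; exact Finset.filter_congr fun p _ => isFirst_congr_fst h p

/-- `firstOcc` depends on the axes only. [cite: MadrasSlade1993, Definition 1.2.4] -/
theorem firstOcc_congr_fst {u u' : Word L n} (h : ∀ p, (u p).1 = (u' p).1) (p : Fin L) : firstOcc u p = firstOcc u' p := by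
  unfold firstOcc; congr 1; exact Finset.filter_congr fun q _ => by rw [h q, h p]

/-- `rank` depends on the axes only. [cite: MadrasSlade1993, Definition 1.2.4] -/
theorem rank_congr_fst {u u' : Word L n} (h : ∀ p, (u p).1 = (u' p).1) (p : Fin L) : rank u p = rank u' p := by
  unfold rank; rw [firsts_congr_fst h, firstOcc_congr_fst h]

/-- `numAxes` depends on the axes only. [cite: MadrasSlade1993, Definition 1.2.4] -/
theorem numAxes_congr_fst {u u' : Word L n} (h : ∀ p, (u p).1 = (u' p).1) : numAxes u = numAxes u' := by
  unfold numAxes; rw [firsts_congr_fst h]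

/-- Flips keep the number of axes. [cite: MadrasSlade1993, Definition 1.2.4] -/
theorem numAxes_flipW (S : Finset (Fin n)) (u : Word L n) : numAxes (flipW S u) = numAxes u :=
  numAxes_congr_fst fun p => flipW_fst S u p

/-- ★ Flips keep canonical words canonical. [cite: MadrasSlade1993, Definition 1.2.4] -/
theorem canon_flipW_of_canon (S : Finset (Fin L)) (τ : Word L L) (hτ : canon τ = τ) : canon (flipW S τ) = flipW S τ := by
  funext p
  have h1 : (canon τ p).1 = (τ p).1 := by rw [hτ]
  refine Prod.ext ?_ rfl
  change (⟨rank (flipW S τ) p, rank_lt _ p⟩ : Fin L) = (flipW S τ p).1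
  rw [flipW_fst, ← h1]
  exact Fin.ext (rank_congr_fst (fun q => flipW_fst S τ q) p)

/-- First occurrences carry the positive sign. [cite: MadrasSlade1993, Definition 1.2.4] -/
abbrev FirstPos (u : Word L n) : Prop := ∀ p : Fin L, IsFirst u p → (u p).2 = true

/-- The axes used by a word. [cite: MadrasSlade1993, Definition 1.2.4] -/
def axesOf (u : Word L n) : Finset (Fin n) := (firsts u).image fun p => (u p).1

/-- The axes whose first occurrence is negative. [cite: MadrasSlade1993, Definition 1.2.4] -/
def negAxes (u : Word L n) : Finset (Fin n) := ((firsts u).filter fun p => (u p).2 = false).image fun p => (u p).1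

/-- The number of axes used is `numAxes`. [cite: MadrasSlade1993, Definition 1.2.4] -/
theorem card_axesOf (u : Word L n) : (axesOf u).card = numAxes u := by
  unfold axesOf numAxes
  exact Finset.card_image_of_injOn fun p hp q hq h =>
    (Finset.mem_filter.1 hp).2.eq_of_axis_eq (Finset.mem_filter.1 hq).2 h

/-- Negative-first axes are used axes. [cite: MadrasSlade1993, Definition 1.2.4] -/
theorem negAxes_subset (u : Word L n) : negAxes u ⊆ axesOf u := by
  unfold negAxes axesOf
  exact Finset.image_subset_image (Finset.filter_subset _ _)

/-- The axes used depend on the axes only. [cite: MadrasSlade1993, Definition 1.2.4] -/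
theorem axesOf_congr_fst {u u' : Word L n} (h : ∀ p, (u p).1 = (u' p).1) : axesOf u = axesOf u' := by
  unfold axesOf; rw [firsts_congr_fst h]; exact Finset.image_congr fun p _ => h p

/-- For a first occurrence `p`, its axis is negative-first iff its sign is negative. [cite: MadrasSlade1993, Definition 1.2.4] -/
theorem mem_negAxes_iff (u : Word L n) {p : Fin L} (hp : IsFirst u p) : (u p).1 ∈ negAxes u ↔ (u p).2 = false := by
  unfold negAxes
  rw [Finset.mem_image]
  constructor
  · rintro ⟨q, hq, hqp⟩
    rw [Finset.mem_filter] at hq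
    have hqf : IsFirst u q := (Finset.mem_filter.1 hq.1).2
    rw [← hqf.eq_of_axis_eq hp hqp]
    exact hq.2
  · intro h
    exact ⟨p, Finset.mem_filter.2 ⟨Finset.mem_filter.2 ⟨Finset.mem_univ _, hp⟩, h⟩, rfl⟩

/-- The normal form: flip the negative-first axes. [cite: MadrasSlade1993, Definition 1.2.4] -/
def normW (u : Word L n) : Word L n := flipW (negAxes u) u

/-- ★ The normal form has positive first occurrences. [cite: MadrasSlade1993, Definition 1.2.4] -/
theorem firstPos_normW (u : Word L n) : FirstPos (normW u) := by
  intro p hp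
  have hax : ∀ q, (normW u q).1 = (u q).1 := fun q => flipW_fst _ u q
  have hp' : IsFirst u p := (isFirst_congr_fst hax p).1 hp
  change (flipW (negAxes u) u p).2 = true
  rw [flipW_snd]
  by_cases hs : (u p).2 = false
  · rw [if_pos ((mem_negAxes_iff u hp').2 hs), hs]; rfl
  · rw [if_neg fun h => hs ((mem_negAxes_iff u hp').1 h)]
    cases h2 : (u p).2
    · exact absurd h2 hs
    · rfl

/-- ★ Flipping a set `S` of used axes of a first-positive word makes exactly the axes of `S` negative-first. [cite: MadrasSlade1993, Definition 1.2.4] -/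
theorem negAxes_flipW (S : Finset (Fin n)) (ρ : Word L n) (hρ : FirstPos ρ) (hS : S ⊆ axesOf ρ) : negAxes (flipW S ρ) = S := by
  have hax : ∀ q, (flipW S ρ q).1 = (ρ q).1 := fun q => flipW_fst S ρ q
  ext x
  constructor
  · intro hx
    unfold negAxes at hx
    obtain ⟨p, hp, rfl⟩ := Finset.mem_image.1 hx
    rw [Finset.mem_filter] at hp
    have hpf : IsFirst ρ p := (isFirst_congr_fst hax p).1 (Finset.mem_filter.1 hp.1).2
    have h2 := hp.2
    rw [flipW_snd, hρ p hpf] at h2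
    rw [flipW_fst]
    by_contra hxS
    rw [if_neg hxS] at h2
    exact Bool.noConfusion h2
  · intro hx
    obtain ⟨p, hp, hpx⟩ := Finset.mem_image.1 (hS hx)
    have hpf : IsFirst ρ p := (Finset.mem_filter.1 hp).2
    have hpf' : IsFirst (flipW S ρ) p := (isFirst_congr_fst hax p).2 hpf
    have hxS : (ρ p).1 ∈ S := by rw [hpx]; exact hx
    rw [← hpx, ← hax p, mem_negAxes_iff _ hpf', flipW_snd, if_pos hxS, hρ p hpf]
    rfl

/-- A word is its normal form flipped back along its negative-first axes. [cite: MadrasSlade1993, Definition 1.2.4] -/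
theorem flipW_negAxes_normW (u : Word L n) : flipW (negAxes u) (normW u) = u := flipW_flipW _ u

/-- ★★ THE FIRST-OCCURRENCE SYMMETRY: on a flip-closed finite set of words, a flip-invariant count of the words with `k` axes is `2^k`
times the count of those with positive first occurrences. [cite: MadrasSlade1993, Definition 1.2.4] -/
theorem card_filter_eq_two_pow_mul_card (T : Finset (Word L n)) (hT : ∀ S, ∀ τ ∈ T, flipW S τ ∈ T)
    (P : Word L n → Prop) [DecidablePred P] (hP : ∀ S τ, P (flipW S τ) ↔ P τ) (k : ℕ) :
    (T.filter fun τ => P τ ∧ numAxes τ = k).card = 2 ^ k * (T.filter fun τ => (P τ ∧ FirstPos τ) ∧ numAxes τ = k).card := by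
  classical
  set A := T.filter fun τ => P τ ∧ numAxes τ = k with hA
  set B := T.filter fun τ => (P τ ∧ FirstPos τ) ∧ numAxes τ = k with hB
  -- normalisation maps `A` into `B`
  have hmaps : ∀ τ ∈ A, normW τ ∈ B := by
    intro τ hτ
    rw [hA, Finset.mem_filter] at hτ
    rw [hB, Finset.mem_filter]
    exact ⟨hT _ _ hτ.1, ⟨(hP _ _).2 hτ.2.1, firstPos_normW τ⟩, by rw [normW, numAxes_flipW]; exact hτ.2.2⟩
  rw [Finset.card_eq_sum_card_fiberwise hmaps]
  -- every fibre is the set of flips of its base point along subsets of its axes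
  have hfib : ∀ ρ ∈ B, (A.filter fun τ => normW τ = ρ).card = 2 ^ k := by
    intro ρ hρ
    rw [hB, Finset.mem_filter] at hρ
    obtain ⟨hρT, ⟨hρP, hρF⟩, hρk⟩ := hρ
    have hEq : (A.filter fun τ => normW τ = ρ) = (axesOf ρ).powerset.image fun S => flipW S ρ := by
      ext τ
      rw [Finset.mem_filter, Finset.mem_image, hA, Finset.mem_filter]
      constructor
      · rintro ⟨⟨hτT, hτP, hτk⟩, hτρ⟩
        refine ⟨negAxes τ, Finset.mem_powerset.2 ?_, ?_⟩
        · rw [← hτρ, normW, axesOf_congr_fst (fun q => flipW_fst (negAxes τ) τ q)]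
          exact negAxes_subset τ
        · rw [← hτρ]; exact flipW_negAxes_normW τ
      · rintro ⟨S, hS, rfl⟩
        rw [Finset.mem_powerset] at hS
        refine ⟨⟨hT _ _ hρT, (hP _ _).2 hρP, by rw [numAxes_flipW]; exact hρk⟩, ?_⟩
        rw [normW, negAxes_flipW S ρ hρF hS, flipW_flipW]
    rw [hEq, Finset.card_image_of_injOn, Finset.card_powerset, card_axesOf, hρk]
    intro S hS S' hS' h
    have hS1 := Finset.mem_powerset.1 (Finset.mem_coe.1 hS)
    have hS2 := Finset.mem_powerset.1 (Finset.mem_coe.1 hS')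
    have := congrArg negAxes h
    simp only at this
    rwa [negAxes_flipW S ρ hρF hS1, negAxes_flipW S' ρ hρF hS2] at this
  rw [Finset.sum_congr rfl hfib, Finset.sum_const, smul_eq_mul, mul_comm]

end flips


/-! ### The reduced policy writes exactly the canonical words with positive first occurrences; the reduced census -/

section reduced

variable {L n : ℕ}

/-- `rgA` = restricted growth plus the policy at every position (read with the running axis count of the prefix before it).
[cite: MadrasSlade1993, Definition 1.2.4] -/
theorem rgA_iff (alw : ℕ → ℕ × Bool → Bool) : ∀ (w : List (ℕ × Bool)) (m : ℕ), rgA alw m w = true ↔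
    rgOK m w = true ∧ ∀ (j : ℕ) (hj : j < w.length), alw (naxL m (w.take j)) (w[j]) = true := by
  intro w
  induction w with
  | nil => intro m; simp [rgA, rgOK]
  | cons a w ih =>
    intro m
    simp only [rgA, rgOK, Bool.and_eq_true, ih, List.length_cons]
    constructor
    · rintro ⟨⟨h1, h2⟩, h3, h4⟩
      refine ⟨⟨h1, h3⟩, fun j hj => ?_⟩
      cases j with
      | zero => simpa [naxL] using h2
      | succ j => simpa [naxL, List.take_succ_cons, List.getElem_cons_succ] using h4 j (by omega)
    · rintro ⟨⟨h1, h3⟩, h4⟩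
      refine ⟨⟨h1, by simpa [naxL] using h4 0 (by omega)⟩, h3, fun j hj => ?_⟩
      have h5 := h4 (j + 1) (by omega)
      rw [List.getElem_cons_succ] at h5
      simpa [naxL, List.take_succ_cons] using h5

/-- For an axis-fixed word the prefix maximum is the number of first occurrences so far. [cite: MadrasSlade1993, Definition 1.2.4] -/
theorem pmN_eq_nf (τ : Word L n) (h : AxFixed τ) (q : Fin L) : pmN τ q.val = nf τ q := by
  apply le_antisymm
  · unfold pmN
    apply Finset.sup_le
    intro r hr
    have hrq : r < q := (Finset.mem_filter.1 hr).2
    rw [h r]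
    exact rank_lt_nf_of_lt τ hrq
  · rcases Nat.eq_zero_or_pos (nf τ q) with h0 | hpos
    · rw [h0]; exact Nat.zero_le _
    · obtain ⟨r, hrf, hrq, hrk⟩ := exists_first_of_lt_nf τ q (i := nf τ q - 1) (by omega)
      have : (τ r).1.val + 1 ≤ pmN τ q.val := by
        unfold pmN
        exact Finset.le_sup (f := fun r : Fin L => (τ r).1.val + 1) (Finset.mem_filter.2 ⟨Finset.mem_univ _, hrq⟩)
      rw [h r, hrk] at this
      omega

/-- ★ In a restricted-growth word, a position is a first occurrence iff its axis equals the running axis count. [cite: MadrasSlade1993, Definition 1.2.4] -/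
theorem isFirst_iff_axis_eq_pmN (τ : Word L n) (h : AxFixed τ) (q : Fin L) : IsFirst τ q ↔ (τ q).1.val = pmN τ q.val := by
  rw [pmN_eq_nf τ h q, h q]
  constructor
  · intro hq
    rw [rank_eq_nf, firstOcc_eq_self τ hq]
  · intro hq
    by_contra hnf
    have hlt : firstOcc τ q < q := lt_of_le_of_ne (firstOcc_le τ rfl) fun heq => hnf (heq ▸ isFirst_firstOcc τ q)
    have h1 : rank τ (firstOcc τ q) < nf τ q := rank_lt_nf (isFirst_firstOcc τ q) hlt
    have h2 : rank τ (firstOcc τ q) = rank τ q := (rank_eq_rank_iff τ _ _).2 (axis_firstOcc τ q)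
    omega

/-- ★★ The reduced policy `alwR` admits exactly the restricted-growth words with positive first occurrences. [cite: MadrasSlade1993, Definition 1.2.4] -/
theorem rgA_alwR_iff (τ : Word L n) : rgA alwR 0 (rawW τ) = true ↔ GrowthOK τ ∧ FirstPos τ := by
  rw [rgA_iff, ← growthOK_iff_rgOK]
  refine and_congr_right fun hg => ?_
  have hfix := hg.axFixed
  constructor
  · intro H p hp
    have hj : p.val < (rawW τ).length := by simp
    have := H p.val hj
    rw [(rgOK_naxL_take τ p.val p.isLt.le).2] at this
    have hget : (rawW τ)[p.val]'hj = raw (τ p) := by simp [rawW, List.getElem_ofFn]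
    rw [hget] at this
    simp only [alwR, raw, Bool.or_eq_true, Bool.not_eq_true', beq_eq_false_iff_ne, ne_eq] at this
    rcases this with hne | hs
    · exact absurd ((isFirst_iff_axis_eq_pmN τ hfix p).1 hp) hne
    · exact hs
  · intro H j hj
    have hjL : j < L := by simpa using hj
    rw [(rgOK_naxL_take τ j hjL.le).2]
    have hget : (rawW τ)[j]'hj = raw (τ ⟨j, hjL⟩) := by simp [rawW, List.getElem_ofFn]
    rw [hget]
    simp only [alwR, raw, Bool.or_eq_true, Bool.not_eq_true', beq_eq_false_iff_ne, ne_eq]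
    by_cases hf : IsFirst τ ⟨j, hjL⟩
    · exact Or.inr (H _ hf)
    · exact Or.inl fun heq => hf ((isFirst_iff_axis_eq_pmN τ hfix ⟨j, hjL⟩).2 heq)

/-- Flips preserve membership in the transversal. [cite: MadrasSlade1993, Definition 1.2.4] -/
theorem flipW_mem_TL (S : Finset (Fin L)) : ∀ τ ∈ TL L, flipW S τ ∈ TL L := fun τ hτ =>
  Finset.mem_filter.2 ⟨Finset.mem_univ _, canon_flipW_of_canon S τ (canon_TL τ hτ)⟩

variable {S : Type*} (upd : S → ℕ × Bool → S) (ok : S → Bool) (cls : ℕ → S → Bool) (s₀ : S)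

/-- ★★★ THE REDUCED CENSUS IN EVERY DIMENSION: if `Q` (on `Word L d`) is type-invariant with a FLIP-INVARIANT canonical form
«the state of every prefix passes `ok` and the class test `cls c` holds at the end», then `#{u : Word L d | Q u} = Σ_{k ≤ L} 2^k n_k · d^{(k)}`
with `n_k = dfsN alwR … c k L s₀ 0` the counts of the REDUCED search (first occurrences positive). [cite: MadrasSlade1993, Definition 1.2.4] -/
theorem card_eq_sum_dfsN_reduced {d : ℕ} (c : ℕ) (Q : Word L d → Prop) [DecidablePred Q]
    (hQ : ∀ u : Word L d, Q u ↔ PrefixOK upd ok s₀ (canon u) ∧ cls c (st upd s₀ (rawW (canon u))) = true)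
    (hflip : ∀ (S' : Finset (Fin L)) (τ : Word L L),
      (PrefixOK upd ok s₀ (flipW S' τ) ∧ cls c (st upd s₀ (rawW (flipW S' τ))) = true) ↔
        (PrefixOK upd ok s₀ τ ∧ cls c (st upd s₀ (rawW τ)) = true))
    (n : ℕ → ℕ) (hn : ∀ k, k ≤ L → dfsN alwR upd ok cls c k L s₀ 0 = n k) :
    (Finset.univ.filter Q).card = ∑ k ∈ Finset.range (L + 1), 2 ^ k * n k * d.descFactorial k := by
  rw [card_filter_eq_sum_TL Q (fun τ => PrefixOK upd ok s₀ τ ∧ cls c (st upd s₀ (rawW τ)) = true) hQ,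
    sum_ite_descFactorial_numAxes]
  refine Finset.sum_congr rfl fun k hk => ?_
  rw [Finset.filter_filter, card_filter_eq_two_pow_mul_card (TL L) flipW_mem_TL _ hflip k,
    ← hn k (Nat.le_of_lt_succ (Finset.mem_range.1 hk)), ← card_TL_class alwR upd ok cls s₀ c k, Finset.filter_filter]
  congr 2
  refine congrArg Finset.card (Finset.filter_congr fun τ hτ => ?_)
  have hg : GrowthOK τ := (growthOK_iff_canon_eq τ).2 (canon_TL τ hτ)
  rw [rgA_alwR_iff]
  exact ⟨fun h => ⟨⟨⟨hg, h.1.2⟩, h.1.1⟩, h.2⟩, fun h => ⟨⟨h.1.2, h.1.1.2⟩, h.2⟩⟩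

end reduced


/-! ### Semantics of the step-walk state: displacements are block sums

For a word `τ : Word L n` the reversed raw prefix of length `i` is the search state after `i` letters (`st_updR`); walking back `j`
letters from its front accumulates the coordinates of the block sum `bsumW τ (i − j) i` (`foldl_addD_coords`, `vecL_take_reverse`);
so `okR n` says that no block ending at `i` vanishes — all prefixes pass iff the word is self-avoiding (`prefixOK_iff_blocks`) — and
`unitR n j` on the full word says that the last `j` letters sum to `±` a unit vector, i.e. one more letter closes them (`unitR_iff_exists_close`). -/

section semantics

variable {L n : ℕ}

/-- The transverse sum of a list of letters. [cite: MadrasSlade1993, Definition 1.2.4] -/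
def vecL (l : List (Idx n)) : Site (n + 1) := (l.map (twoStepV n)).sum

/-- The transverse coordinates of a site vector, as a list indexed by axis. [cite: MadrasSlade1993, Definition 1.2.4] -/
def coords (v : Site (n + 1)) : List ℤ := List.ofFn fun x : Fin n => v x.succ

/-- `vecL` of a cons. [cite: MadrasSlade1993, Definition 1.2.4] -/
theorem vecL_cons (a : Idx n) (l : List (Idx n)) : vecL (a :: l) = twoStepV n a + vecL l := by
  simp [vecL]

/-- `vecL` of an append. [cite: MadrasSlade1993, Definition 1.2.4] -/
theorem vecL_append (l₁ l₂ : List (Idx n)) : vecL (l₁ ++ l₂) = vecL l₁ + vecL l₂ := by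
  simp [vecL, List.sum_append]

/-- `vecL` of a reversal. [cite: MadrasSlade1993, Definition 1.2.4] -/
theorem vecL_reverse (l : List (Idx n)) : vecL l.reverse = vecL l := by
  simp [vecL, List.sum_reverse]

/-- A transverse sum has zero height coordinate. [cite: MadrasSlade1993, Definition 1.2.4] -/
theorem vecL_apply_zero (l : List (Idx n)) : vecL l 0 = 0 := by
  induction l with
  | nil => rfl
  | cons a l ih => rw [vecL_cons, Pi.add_apply, ih, twoStepV_apply_zero, add_zero]

/-- Modifying one entry of `List.ofFn`. [cite: MadrasSlade1993, Definition 1.2.4] -/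
theorem modify_ofFn {α : Type*} (f : Fin n → α) (i : ℕ) (g : α → α) :
    (List.ofFn f).modify i g = List.ofFn fun x => if x.val = i then g (f x) else f x := by
  apply List.ext_getElem
  · simp
  · intro k h1 h2
    rw [List.getElem_modify, List.getElem_ofFn, List.getElem_ofFn]
    by_cases h : i = k
    · subst h; simp
    · rw [if_neg h, if_neg (fun h' : (⟨k, _⟩ : Fin n).val = i => h h'.symm)]

/-- ★ Adding a raw letter to the coordinates adds the letter's transverse step. [cite: MadrasSlade1993, Definition 1.2.4] -/
theorem addD_coords (v : Site (n + 1)) (a : Idx n) : addD (coords v) (raw a) = coords (v + twoStepV n a) := by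
  unfold addD coords raw
  rw [modify_ofFn]
  congr 1
  funext x
  rw [Pi.add_apply, twoStepV_apply_succ]
  by_cases h : x = a.1
  · subst h; simp [sgZ, sgnV]
  · rw [if_neg (fun h' => h (Fin.ext h')), if_neg h, add_zero]

/-- Folding raw letters into coordinates accumulates their transverse sum. [cite: MadrasSlade1993, Definition 1.2.4] -/
theorem foldl_addD_coords : ∀ (l : List (Idx n)) (v : Site (n + 1)), (l.map raw).foldl addD (coords v) = coords (v + vecL l) := by
  intro l
  induction l with
  | nil => intro v; simp [vecL]
  | cons a l ih => intro v; rw [List.map_cons, List.foldl_cons, addD_coords, ih, vecL_cons, add_assoc]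

/-- The zero coordinates are those of the zero vector. [cite: MadrasSlade1993, Definition 1.2.4] -/
theorem coords_zero : coords (0 : Site (n + 1)) = List.replicate n 0 := by
  unfold coords; simp [List.ofFn_const]

/-- ★ `isZ` on coordinates: the vector vanishes (given zero height). [cite: MadrasSlade1993, Definition 1.2.4] -/
theorem isZ_coords_iff (v : Site (n + 1)) (hv : v 0 = 0) : isZ (coords v) = true ↔ v = 0 := by
  unfold isZ coords
  rw [List.all_eq_true]
  constructor
  · intro h
    funext i
    refine Fin.cases ?_ (fun x => ?_) i
    · exact hv
    · have := h (v x.succ) (List.mem_ofFn.2 ⟨x, rfl⟩)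
      simpa using this
  · intro h z hz
    obtain ⟨x, rfl⟩ := List.mem_ofFn.1 hz
    simp [h]

/-- ★ `retZ` on coordinates: some nonempty initial run of the letters brings the accumulated vector to zero. [cite: MadrasSlade1993, Definition 1.2.4] -/
theorem retZ_coords_iff : ∀ (l : List (Idx n)) (v : Site (n + 1)), v 0 = 0 →
    (retZ (coords v) (l.map raw) = true ↔ ∃ j, 0 < j ∧ j ≤ l.length ∧ v + vecL (l.take j) = 0) := by
  intro l
  induction l with
  | nil =>
    intro v _
    simp [retZ]
  | cons a l ih =>
    intro v hv
    have hv' : (v + twoStepV n a) 0 = 0 := by rw [Pi.add_apply, hv, twoStepV_apply_zero, add_zero]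
    rw [List.map_cons, retZ, addD_coords, Bool.or_eq_true, isZ_coords_iff _ hv', ih _ hv']
    constructor
    · rintro (h | ⟨j, hj0, hjl, hj⟩)
      · exact ⟨1, Nat.one_pos, by simp, by simpa [vecL] using h⟩
      · exact ⟨j + 1, Nat.succ_pos _, by simpa using hjl, by rw [List.take_succ_cons, vecL_cons, ← add_assoc]; exact hj⟩
    · rintro ⟨j, hj0, hjl, hj⟩
      obtain ⟨j, rfl⟩ : ∃ j', j = j' + 1 := ⟨j - 1, by omega⟩
      rw [List.take_succ_cons, vecL_cons, ← add_assoc] at hj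
      rcases Nat.eq_zero_or_pos j with rfl | hpos
      · left; simpa [vecL] using hj
      · right; exact ⟨j, hpos, by simpa using hjl, hj⟩

end semantics


section semantics2

variable {L n : ℕ}

/-- The reversed-prefix state is the reversed prefix. [cite: MadrasSlade1993, Definition 1.2.4] -/
theorem st_updR (s₀ w : List (ℕ × Bool)) : st updR s₀ w = w.reverse ++ s₀ := by
  unfold st
  induction w generalizing s₀ with
  | nil => rfl
  | cons a w ih => rw [List.foldl_cons, ih]; simp [updR]

/-- One more step in a block sum. [cite: MadrasSlade1993, Definition 1.2.4] -/
theorem bsumW_succ (w : Word L n) {a m : ℕ} (ham : a ≤ m) (hm : m < L) :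
    bsumW w a (m + 1) = bsumW w a m + twoStepV n (w ⟨m, hm⟩) := by
  unfold bsumW
  have hsplit : (Finset.univ.filter fun p : Fin L => a ≤ p.val ∧ p.val < m + 1) =
      insert (⟨m, hm⟩ : Fin L) (Finset.univ.filter fun p : Fin L => a ≤ p.val ∧ p.val < m) := by
    ext p
    simp only [Finset.mem_filter, Finset.mem_univ, true_and, Finset.mem_insert, Fin.ext_iff]
    omega
  have hnot : (⟨m, hm⟩ : Fin L) ∉ Finset.univ.filter fun p : Fin L => a ≤ p.val ∧ p.val < m := by simp
  rw [hsplit, Finset.sum_insert hnot]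
  exact add_comm _ _

/-- The empty block. [cite: MadrasSlade1993, Definition 1.2.4] -/
theorem bsumW_self (w : Word L n) (a : ℕ) : bsumW w a a = 0 := by
  unfold bsumW
  rw [Finset.filter_eq_empty_iff.2 (fun p _ h => absurd (lt_of_le_of_lt h.1 h.2) (lt_irrefl _)), Finset.sum_empty]

/-- ★ The transverse sum of a window of the letter list is the block sum. [cite: MadrasSlade1993, Definition 1.2.4] -/
theorem vecL_take_drop (τ : Word L n) (a : ℕ) : ∀ b : ℕ, a + b ≤ L → vecL (((List.ofFn τ).drop a).take b) = bsumW τ a (a + b) := by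
  intro b
  induction b with
  | zero => intro _; simp [vecL, bsumW_self]
  | succ b ih =>
    intro hab
    have hlt : a + b < L := by omega
    rw [List.take_add_one, List.getElem?_drop, List.getElem?_ofFn, dif_pos hlt]
    simp only [Option.toList_some]
    rw [vecL_append, ih hlt.le, ← Nat.add_assoc, bsumW_succ τ (Nat.le_add_right a b) hlt]
    simp [vecL]

/-- ★ Walking back `j ≤ i` letters from the end of the prefix of length `i` sums the block `[i − j, i)`. [cite: MadrasSlade1993, Definition 1.2.4] -/
theorem vecL_take_reverse (τ : Word L n) {i j : ℕ} (hi : i ≤ L) (hj : j ≤ i) :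
    vecL ((((List.ofFn τ).take i).reverse).take j) = bsumW τ (i - j) i := by
  rw [List.take_reverse, vecL_reverse, List.length_take, List.length_ofFn, Nat.min_eq_left hi, List.drop_take,
    vecL_take_drop τ (i - j) (i - (i - j)) (by omega)]
  congr 1; omega

/-- The raw word is the letter list mapped to raw letters. [cite: MadrasSlade1993, Definition 1.2.4] -/
theorem rawW_eq_map (τ : Word L n) : rawW τ = (List.ofFn τ).map raw := by
  unfold rawW; rw [List.map_ofFn]; rfl

/-- A block sum has zero height coordinate. [cite: MadrasSlade1993, Definition 1.2.4] -/
theorem bsumW_apply_zero (w : Word L n) (i j : ℕ) : bsumW w i j 0 = 0 := by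
  unfold bsumW
  rw [Finset.sum_apply]
  exact Finset.sum_eq_zero fun p _ => twoStepV_apply_zero n (w p)

/-- ★★ THE PRUNING TEST READ: after the first `i` letters, `okR n` holds iff no block ending at `i` vanishes. [cite: MadrasSlade1993, Definition 1.2.4] -/
theorem okR_st_iff (τ : Word L n) {i : ℕ} (hi : i ≤ L) :
    okR n (st updR [] ((rawW τ).take i)) = true ↔ ∀ j, 0 < j → j ≤ i → bsumW τ (i - j) i ≠ 0 := by
  rw [okR, st_updR, List.append_nil, rawW_eq_map, ← List.map_take, ← List.map_reverse, ← coords_zero,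
    Bool.not_eq_true', ← Bool.not_eq_true, retZ_coords_iff _ _ rfl]
  simp only [zero_add, List.length_reverse, List.length_take, List.length_ofFn, Nat.min_eq_left hi, not_exists, not_and]
  refine forall_congr' fun j => forall_congr' fun hj0 => forall_congr' fun hji => ?_
  rw [vecL_take_reverse τ hi hji]

/-- ★★ ALL PREFIXES PASS THE PRUNING TEST IFF THE WORD IS SELF-AVOIDING (no block of steps vanishes). [cite: MadrasSlade1993, Definition 1.2.4] -/
theorem prefixOK_iff_blocks (τ : Word L n) :
    PrefixOK updR (okR n) ([] : List (ℕ × Bool)) τ ↔ ∀ i j : ℕ, i < j → j ≤ L → bsumW τ i j ≠ 0 := by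
  constructor
  · intro h i j hij hjL
    have := (okR_st_iff τ hjL).1 (h ⟨j, Nat.lt_succ_of_le hjL⟩) (j - i) (by omega) (by omega)
    rwa [show j - (j - i) = i by omega] at this
  · intro h i
    rw [okR_st_iff τ (Nat.le_of_lt_succ i.isLt)]
    intro j hj0 hji
    exact h _ _ (by omega) (Nat.le_of_lt_succ i.isLt)

/-- `Σ |coords|` of a vector `−e_x`-shaped sum: the unit test on coordinates. [cite: MadrasSlade1993, Definition 1.2.4] -/
theorem isUnit_coords_iff (v : Site (n + 1)) (hv : v 0 = 0) : isUnit (coords v) = true ↔ ∃ x : Idx n, v + twoStepV n x = 0 := by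
  unfold isUnit coords
  rw [beq_iff_eq, List.map_ofFn, List.sum_ofFn]
  simp only [Function.comp_apply]
  constructor
  · intro h
    -- one coordinate has absolute value one, the others vanish
    obtain ⟨y, -, hy⟩ := Finset.exists_ne_zero_of_sum_ne_zero (by rw [h]; exact one_ne_zero)
    have hsplit := Finset.add_sum_erase Finset.univ (fun z : Fin n => (v z.succ).natAbs) (Finset.mem_univ y)
    rw [h] at hsplit
    have hy1 : (v y.succ).natAbs = 1 := by
      have : (v y.succ).natAbs ≤ 1 := by rw [← hsplit]; exact Nat.le_add_right _ _
      omega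
    have hrest : ∀ z, z ≠ y → v z.succ = 0 := by
      intro z hz
      have h0 : ∑ z ∈ Finset.univ.erase y, (v z.succ).natAbs = 0 := by omega
      exact Int.natAbs_eq_zero.1 (Finset.sum_eq_zero_iff.1 h0 z (Finset.mem_erase.2 ⟨hz, Finset.mem_univ _⟩))
    -- the closing letter: axis `y`, sign opposite to the coordinate
    have key : ∀ b : Bool, v y.succ = -sgZ b → v + twoStepV n (y, b) = 0 := by
      intro b hb
      funext i
      refine Fin.cases ?_ (fun z => ?_) i
      · rw [Pi.add_apply, hv, twoStepV_apply_zero, add_zero]; rfl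
      · rw [Pi.add_apply, twoStepV_apply_succ, Pi.zero_apply]
        by_cases hz : z = y
        · subst hz; rw [if_pos rfl, hb]; simp [sgZ, sgnV]
        · rw [if_neg hz, hrest z hz, add_zero]
    rcases Int.natAbs_eq_iff.1 hy1 with h1 | h1
    · exact ⟨(y, false), key false (by rw [h1]; simp [sgZ])⟩
    · exact ⟨(y, true), key true (by rw [h1]; simp [sgZ])⟩
  · rintro ⟨x, hx⟩
    have hv' : ∀ z : Fin n, v z.succ = -(twoStepV n x) z.succ := fun z => by
      have := congrFun hx z.succ
      rw [Pi.add_apply, Pi.zero_apply] at this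
      omega
    simp only [hv', twoStepV_apply_succ]
    rw [Finset.sum_eq_single x.1]
    · rw [if_pos rfl]; simp [sgnV]; split_ifs <;> simp
    · intro z _ hz; rw [if_neg hz]; simp
    · intro h; exact absurd (Finset.mem_univ _) h

/-- ★★ THE CLASS TEST READ (full word): `unitR n j` holds iff the last `j ≤ L` letters are closed by one more letter. [cite: MadrasSlade1993, §1.2] -/
theorem unitR_st_iff (τ : Word L n) {j : ℕ} (hj : j ≤ L) :
    unitR n j (st updR [] (rawW τ)) = true ↔ ∃ x : Idx n, bsumW τ (L - j) L + twoStepV n x = 0 := by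
  have hrev : vecL (((List.ofFn τ).reverse).take j) = bsumW τ (L - j) L := by
    have := vecL_take_reverse τ le_rfl hj
    have e : (List.ofFn τ).take L = List.ofFn τ := List.take_of_length_le (by simp)
    rw [e] at this
    exact this
  rw [unitR, sumD, st_updR, List.append_nil, rawW_eq_map, ← List.map_reverse, ← List.map_take, ← coords_zero,
    foldl_addD_coords, zero_add, hrev]
  exact isUnit_coords_iff _ (bsumW_apply_zero τ _ _)

end semantics2


/-! ### The classes of the ten-step census at word length 8, read in every dimension

Word-level classes (type-invariant and flip-invariant): `SAW8 u` — no block of the eight-letter word vanishes (the word of an eight-step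
self-avoiding walk); `TailClose i u` — the tail from position `i` is closed by one more letter (one of its letters is left over while the
others cancel).  The raw search tests mean exactly these on canonical words (`search_iff_class`), so the reduced census theorem and the
kernel cell `dfsV_eight_reduced` give the four class counts as polynomials in `d`. -/

section tenclasses

variable {d : ℕ}

/-- The word of an eight-step self-avoiding walk: no block of steps vanishes. [cite: MadrasSlade1993, §1.2] -/
abbrev SAW8 (u : Word 8 d) : Prop := ∀ i j : Fin 9, i < j → bsumW u i.val j.val ≠ 0

/-- The tail positions `≥ i` of an eight-letter word. [cite: MadrasSlade1993, Definition 1.2.4] -/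
def tail8 (i : ℕ) : Finset (Fin 8) := Finset.univ.filter fun q : Fin 8 => i ≤ q.val

/-- The tail from position `i` is closed by one more letter: one of its letters left over, the others cancel. [cite: MadrasSlade1993, §1.2] -/
abbrev TailClose (i : ℕ) (u : Word 8 d) : Prop := ∃ p : Fin 8, i ≤ p.val ∧ ∑ q ∈ (tail8 i).erase p, twoStepV d (u q) = 0

/-- `SAW8` with natural indices. [cite: MadrasSlade1993, §1.2] -/
theorem saw8_iff_blocks (u : Word 8 d) : SAW8 u ↔ ∀ i j : ℕ, i < j → j ≤ 8 → bsumW u i j ≠ 0 := by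
  constructor
  · intro h i j hij hj
    exact h ⟨i, by omega⟩ ⟨j, by omega⟩ (Fin.mk_lt_mk.2 hij)
  · intro h i j hij
    exact h i.val j.val hij (Nat.le_of_lt_succ j.isLt)

/-- ★ `SAW8` is self-avoidance of the step word. [cite: MadrasSlade1993, §1.2] -/
theorem isSAW_iff_saw8 (u : Word 8 d) : Percolation.IsSAW u ↔ SAW8 u := by
  rw [isSAW_iff_blocks, saw8_iff_blocks]

/-- The tail sum is the block sum `[i, 8)`. [cite: MadrasSlade1993, Definition 1.2.4] -/
theorem sum_tail8 (u : Word 8 d) (i : ℕ) : ∑ q ∈ tail8 i, twoStepV d (u q) = bsumW u i 8 := by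
  unfold bsumW tail8
  refine Finset.sum_congr ?_ fun _ _ => rfl
  ext q
  simp only [Finset.mem_filter, Finset.mem_univ, true_and]
  exact ⟨fun h => ⟨h, q.isLt⟩, fun h => h.1⟩

/-- ★ `TailClose i` iff one more letter closes the tail `[i, 8)`. [cite: MadrasSlade1993, §1.2] -/
theorem tailClose_iff_exists (u : Word 8 d) (i : ℕ) : TailClose i u ↔ ∃ x : Idx d, bsumW u i 8 + twoStepV d x = 0 := by
  rw [← sum_tail8, exists_close_iff]
  constructor
  · rintro ⟨p, hp, h⟩; exact ⟨p, by unfold tail8; simp [hp], h⟩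
  · rintro ⟨p, hp, h⟩
    refine ⟨p, ?_, h⟩
    unfold tail8 at hp; simpa using hp

/-- `SAW8` is a type invariant. [cite: MadrasSlade1993, Definition 1.2.4] -/
theorem saw8_iff_canon (u : Word 8 d) : SAW8 u ↔ SAW8 (canon u) := by
  unfold SAW8 bsumW
  simp only [ne_eq, (sameType_canon u).sum_eq_zero_iff]

/-- `TailClose` is a type invariant. [cite: MadrasSlade1993, Definition 1.2.4] -/
theorem tailClose_iff_canon (u : Word 8 d) (i : ℕ) : TailClose i u ↔ TailClose i (canon u) := by
  unfold TailClose
  simp only [(sameType_canon u).sum_eq_zero_iff]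

/-- ★ A block sum of a flipped word vanishes iff the original one does. [cite: MadrasSlade1993, Definition 1.2.4] -/
theorem sum_flipW_eq_zero_iff {L n : ℕ} (S : Finset (Fin n)) (u : Word L n) (t : Finset (Fin L)) :
    ∑ p ∈ t, twoStepV n (flipW S u p) = 0 ↔ ∑ p ∈ t, twoStepV n (u p) = 0 := by
  rw [sum_twoStepV_eq_zero_iff, sum_twoStepV_eq_zero_iff]
  have key : ∀ (x : Fin n) (b : Bool), (t.filter fun p => flipW S u p = (x, b)) =
      t.filter fun p => u p = (x, if x ∈ S then !b else b) := by
    intro x b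
    refine Finset.filter_congr fun p _ => ?_
    unfold flipW
    obtain ⟨y, c⟩ := u p
    by_cases hy : y ∈ S
    · simp only [hy, if_true, Prod.mk.injEq]
      constructor
      · rintro ⟨rfl, rfl⟩; exact ⟨rfl, by rw [if_pos hy]; simp⟩
      · rintro ⟨rfl, hc⟩; rw [if_pos hy] at hc; exact ⟨rfl, by rw [hc]; simp⟩
    · simp only [hy, if_false, Prod.mk.injEq]
      constructor
      · rintro ⟨rfl, rfl⟩; exact ⟨rfl, by rw [if_neg hy]⟩
      · rintro ⟨rfl, hc⟩; rw [if_neg hy] at hc; exact ⟨rfl, hc⟩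
  refine forall_congr' fun x => ?_
  rw [key x true, key x false]
  by_cases hx : x ∈ S
  · simp only [hx, if_true, Bool.not_true, Bool.not_false]; exact eq_comm
  · simp only [hx, if_false]

/-- `SAW8` is flip-invariant. [cite: MadrasSlade1993, Definition 1.2.4] -/
theorem saw8_flipW_iff (S : Finset (Fin 8)) (τ : Word 8 8) : SAW8 (flipW S τ) ↔ SAW8 τ := by
  unfold SAW8 bsumW
  simp only [ne_eq, sum_flipW_eq_zero_iff]

/-- `TailClose` is flip-invariant. [cite: MadrasSlade1993, Definition 1.2.4] -/
theorem tailClose_flipW_iff (S : Finset (Fin 8)) (τ : Word 8 8) (i : ℕ) : TailClose i (flipW S τ) ↔ TailClose i τ := by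
  unfold TailClose
  simp only [sum_flipW_eq_zero_iff]

/-- The word-level classes of the census: all / square- / hexagon- / octagon-closer behind the ninth step. [cite: MadrasSlade1993, §1.2] -/
abbrev Cls8 (c : ℕ) (u : Word 8 d) : Prop := c = 0 ∨ (c = 1 ∧ TailClose 5 u) ∨ (c = 2 ∧ TailClose 3 u) ∨ (c = 3 ∧ TailClose 1 u)

/-- ★★ THE SEARCH TESTS MEAN THE CLASSES: on a word of `Word 8 8`, «every prefix passes `okR 8` and `clsR8 c` holds» iff «`SAW8` and class `c`»
(`c ≤ 3`). [cite: MadrasSlade1993, §1.2] -/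
theorem search_iff_class (τ : Word 8 8) {c : ℕ} (hc : c < 4) :
    (PrefixOK updR (okR 8) ([] : List (ℕ × Bool)) τ ∧ clsR8 c (st updR [] (rawW τ)) = true) ↔ (SAW8 τ ∧ Cls8 c τ) := by
  rw [prefixOK_iff_blocks, ← saw8_iff_blocks]
  refine and_congr_right fun _ => ?_
  have h3 := unitR_st_iff τ (j := 3) (by norm_num)
  have h5 := unitR_st_iff τ (j := 5) (by norm_num)
  have h7 := unitR_st_iff τ (j := 7) (by norm_num)
  rw [← tailClose_iff_exists] at h3 h5 h7
  unfold Cls8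
  interval_cases c
  · simp [clsR8]
  · rw [clsR8, h3]; simp
  · rw [clsR8, h5]; simp
  · rw [clsR8, h7]; simp

/-- `Cls8` is a type invariant. [cite: MadrasSlade1993, Definition 1.2.4] -/
theorem cls8_iff_canon (u : Word 8 d) (c : ℕ) : Cls8 c u ↔ Cls8 c (canon u) := by
  unfold Cls8
  simp only [tailClose_iff_canon u]

/-- `Cls8` is flip-invariant. [cite: MadrasSlade1993, Definition 1.2.4] -/
theorem cls8_flipW_iff (S : Finset (Fin 8)) (τ : Word 8 8) (c : ℕ) : Cls8 c (flipW S τ) ↔ Cls8 c τ := by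
  unfold Cls8
  simp only [tailClose_flipW_iff]

/-- The reduced class counts by number of axes, read off `tab8`. [cite: MadrasSlade1993, Appendix C, Table C.1] -/
def nTab (c k : ℕ) : ℕ := (tab8.getD c []).getD k 0

/-- ★★ THE FOUR CENSUSES IN EVERY DIMENSION: `#{u : Word 8 d | SAW8 u ∧ Cls8 c u} = Σ_{k ≤ 8} 2^k · tab8[c][k] · d^{(k)}` (`c ≤ 3`).
[cite: MadrasSlade1993, Appendix C, Table C.1] -/
theorem card_saw8_cls (d c : ℕ) (hc : c < 4) :
    (Finset.univ.filter fun u : Word 8 d => SAW8 u ∧ Cls8 c u).card = ∑ k ∈ Finset.range 9, 2 ^ k * nTab c k * d.descFactorial k := by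
  refine card_eq_sum_dfsN_reduced updR (okR 8) clsR8 ([] : List (ℕ × Bool)) c (fun u : Word 8 d => SAW8 u ∧ Cls8 c u)
    (fun u => ?_) (fun S τ => ?_) (nTab c) (fun k hk => ?_)
  · rw [search_iff_class _ hc, ← saw8_iff_canon, ← cls8_iff_canon]
  · rw [search_iff_class _ hc, search_iff_class _ hc, saw8_flipW_iff, cls8_flipW_iff]
  · exact dfsN_eq_of_table alwR updR (okR 8) clsR8 [] (by norm_num) tab8 rfl (by decide) (by decide) dfsV_eight_reduced hc hk

/-- ★★ `c₈(ℤ^d)` BY TYPES (third route): `#{SAW8} = 2d^(1) + 2956d^(2) + 61704d^(3) + 184576d^(4) + 158304d^(5) + 50304d^(6) + 6272d^(7) + 256d^(8)`.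
[cite: MadrasSlade1993, Appendix C, Table C.1] -/
theorem card_saw8 (d : ℕ) : (Finset.univ.filter fun u : Word 8 d => SAW8 u).card =
    2 * d.descFactorial 1 + 2956 * d.descFactorial 2 + 61704 * d.descFactorial 3 + 184576 * d.descFactorial 4 +
      158304 * d.descFactorial 5 + 50304 * d.descFactorial 6 + 6272 * d.descFactorial 7 + 256 * d.descFactorial 8 := by
  have h := card_saw8_cls d 0 (by norm_num)
  have e : (Finset.univ.filter fun u : Word 8 d => SAW8 u ∧ Cls8 0 u) = Finset.univ.filter fun u : Word 8 d => SAW8 u :=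
    Finset.filter_congr fun u _ => ⟨fun h => h.1, fun h => ⟨h, Or.inl rfl⟩⟩
  rw [e] at h
  rw [h]
  simp [Finset.sum_range_succ, nTab, tab8]

/-- ★★ THE SQUARE-CLOSER CENSUS: `#{SAW8 ∧ TailClose 5} = 496d^(2) + 8152d^(3) + 18192d^(4) + 10944d^(5) + 2176d^(6) + 128d^(7)`.
[cite: MadrasSlade1993, Appendix C, Table C.1] -/
theorem card_sq8 (d : ℕ) : (Finset.univ.filter fun u : Word 8 d => SAW8 u ∧ TailClose 5 u).card =
    496 * d.descFactorial 2 + 8152 * d.descFactorial 3 + 18192 * d.descFactorial 4 + 10944 * d.descFactorial 5 +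
      2176 * d.descFactorial 6 + 128 * d.descFactorial 7 := by
  have h := card_saw8_cls d 1 (by norm_num)
  have e : (Finset.univ.filter fun u : Word 8 d => SAW8 u ∧ Cls8 1 u) = Finset.univ.filter fun u : Word 8 d => SAW8 u ∧ TailClose 5 u :=
    Finset.filter_congr fun u _ => by unfold Cls8; simp
  rw [e] at h
  rw [h]
  simp [Finset.sum_range_succ, nTab, tab8]

/-- ★★ THE HEXAGON-CLOSER CENSUS: `#{SAW8 ∧ TailClose 3} = 156d^(2) + 3528d^(3) + 6464d^(4) + 2624d^(5) + 256d^(6)`.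
[cite: MadrasSlade1993, Appendix C, Table C.1] -/
theorem card_hx8 (d : ℕ) : (Finset.univ.filter fun u : Word 8 d => SAW8 u ∧ TailClose 3 u).card =
    156 * d.descFactorial 2 + 3528 * d.descFactorial 3 + 6464 * d.descFactorial 4 + 2624 * d.descFactorial 5 + 256 * d.descFactorial 6 := by
  have h := card_saw8_cls d 2 (by norm_num)
  have e : (Finset.univ.filter fun u : Word 8 d => SAW8 u ∧ Cls8 2 u) = Finset.univ.filter fun u : Word 8 d => SAW8 u ∧ TailClose 3 u :=
    Finset.filter_congr fun u _ => by unfold Cls8; simp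
  rw [e] at h
  rw [h]
  simp [Finset.sum_range_succ, nTab, tab8]

/-- ★★ THE OCTAGON-CLOSER CENSUS: `#{SAW8 ∧ TailClose 1} = 88d^(2) + 1904d^(3) + 3456d^(4) + 864d^(5)`.
[cite: MadrasSlade1993, Appendix C, Table C.1] -/
theorem card_oct8 (d : ℕ) : (Finset.univ.filter fun u : Word 8 d => SAW8 u ∧ TailClose 1 u).card =
    88 * d.descFactorial 2 + 1904 * d.descFactorial 3 + 3456 * d.descFactorial 4 + 864 * d.descFactorial 5 := by
  have h := card_saw8_cls d 3 (by norm_num)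
  have e : (Finset.univ.filter fun u : Word 8 d => SAW8 u ∧ Cls8 3 u) = Finset.univ.filter fun u : Word 8 d => SAW8 u ∧ TailClose 1 u :=
    Finset.filter_congr fun u _ => by unfold Cls8; simp
  rw [e] at h
  rw [h]
  simp [Finset.sum_range_succ, nTab, tab8]

end tenclasses


/-! ### «ZD-TEN-STEP»: the last letter of a nine-letter word, and `c₉(ℤ^d)` in every dimension

A nine-letter word `(u, x)` is self-avoiding iff `u` is (`SAW8`) and `x` closes none of the four even tails of `u` (from positions
7, 5, 3, 1); the tail from 7 is always closed by exactly one letter (the reversal), each other one by one letter iff `TailClose`, and no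
letter closes two tails of a self-avoiding word.  Hence `#SAW9 + #SAW8 + #Sq + #Hx + #Oct = 2d · #SAW8`, and with `#SAW8 = c₈(ℤ^d)`
(`…ZdNineStep`) and the three censuses above: `c₉(ℤ^d)` for every `d`; by `SAWIrreducibleBridgeSpanOne` it is the cost-9 column entry
`N_{9,10}(ℤ^{d+1})` of the pulled large-force expansion. -/

section tenstep

variable {d : ℕ}

/-- Blocks of `(u, x)` inside the first eight letters are blocks of `u`. [cite: MadrasSlade1993, Definition 1.2.4] -/
theorem bsumW_snoc_of_le8 (u : Word 8 d) (x : Idx d) {i j : ℕ} (hj : j ≤ 8) :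
    bsumW (Fin.snoc u x : Word 9 d) i j = bsumW u i j := by
  unfold bsumW
  rw [Finset.sum_filter, Finset.sum_filter, Fin.sum_univ_castSucc]
  simp only [Fin.val_castSucc, Fin.snoc_castSucc, Fin.val_last]
  rw [if_neg (by omega), add_zero]

/-- The tail blocks of `(u, x)` are the tails of `u` plus the new step. [cite: MadrasSlade1993, Definition 1.2.4] -/
theorem bsumW_snoc_nine (u : Word 8 d) (x : Idx d) {i : ℕ} (hi : i ≤ 8) :
    bsumW (Fin.snoc u x : Word 9 d) i 9 = bsumW u i 8 + twoStepV d x := by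
  unfold bsumW
  rw [Finset.sum_filter, Finset.sum_filter, Fin.sum_univ_castSucc]
  simp only [Fin.val_castSucc, Fin.snoc_castSucc, Fin.val_last, Fin.snoc_last]
  rw [if_pos ⟨hi, by norm_num⟩]
  congr 1
  refine Finset.sum_congr rfl fun p _ => ?_
  have hp := p.is_lt
  by_cases h : i ≤ p.val
  · rw [if_pos ⟨h, by omega⟩, if_pos ⟨h, hp⟩]
  · rw [if_neg (fun hh => h hh.1), if_neg (fun hh => h hh.1)]

/-- ★ THE LAST LETTER: `(u, x)` is self-avoiding iff `u` is and `x` closes none of the four even tails. [cite: MadrasSlade1993, §1.2] -/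
theorem isSAW_snoc_iff8 (u : Word 8 d) (x : Idx d) :
    Percolation.IsSAW (Fin.snoc u x : Word 9 d) ↔ SAW8 u ∧ bsumW u 7 8 + twoStepV d x ≠ 0 ∧ bsumW u 5 8 + twoStepV d x ≠ 0 ∧
      bsumW u 3 8 + twoStepV d x ≠ 0 ∧ bsumW u 1 8 + twoStepV d x ≠ 0 := by
  rw [isSAW_iff_even_blocks, saw8_iff_blocks]
  constructor
  · intro h
    refine ⟨fun i j hij hj => ?_, ?_, ?_, ?_, ?_⟩
    · by_cases he : (j - i) % 2 = 0
      · have := h i j hij (by omega) he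
        rwa [bsumW_snoc_of_le8 u x hj] at this
      · exact bsumW_ne_zero_of_odd u hj (by omega)
    · have := h 7 9 (by norm_num) (by norm_num) (by norm_num); rwa [bsumW_snoc_nine u x (by norm_num)] at this
    · have := h 5 9 (by norm_num) (by norm_num) (by norm_num); rwa [bsumW_snoc_nine u x (by norm_num)] at this
    · have := h 3 9 (by norm_num) (by norm_num) (by norm_num); rwa [bsumW_snoc_nine u x (by norm_num)] at this
    · have := h 1 9 (by norm_num) (by norm_num) (by norm_num); rwa [bsumW_snoc_nine u x (by norm_num)] at this
  · rintro ⟨h8, t7, t5, t3, t1⟩ i j hij hj he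
    rcases Nat.lt_or_ge j 9 with hj9 | hj9
    · rw [bsumW_snoc_of_le8 u x (by omega)]
      exact h8 i j hij (by omega)
    · have hj' : j = 9 := by omega
      subst hj'
      rw [bsumW_snoc_nine u x (by omega)]
      have : i = 1 ∨ i = 3 ∨ i = 5 ∨ i = 7 := by omega
      rcases this with rfl | rfl | rfl | rfl
      exacts [t1, t3, t5, t7]

/-- Block additivity inside an eight-letter word: `[i, 8) = [i, j) + [j, 8)`. [cite: MadrasSlade1993, Definition 1.2.4] -/
theorem bsumW_split8 (u : Word 8 d) {i j : ℕ} (hij : i ≤ j) : bsumW u i 8 = bsumW u i j + bsumW u j 8 := by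
  unfold bsumW
  rw [← Finset.sum_union]
  · refine Finset.sum_congr ?_ fun _ _ => rfl
    ext p
    simp only [Finset.mem_filter, Finset.mem_univ, true_and, Finset.mem_union]
    omega
  · rw [Finset.disjoint_filter]
    intro p _ h1 h2
    omega

/-- Two different tails of a self-avoiding eight-letter word cannot both be closed by the same letter. [cite: MadrasSlade1993, §1.2] -/
theorem tail_ne_tail8 (u : Word 8 d) {i j : ℕ} (hij : i < j) (hblock : bsumW u i j ≠ 0) (x : Idx d)
    (hi0 : bsumW u i 8 + twoStepV d x = 0) (hj0 : bsumW u j 8 + twoStepV d x = 0) : False := by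
  apply hblock
  rw [bsumW_split8 u hij.le, add_assoc, hj0, add_zero] at hi0
  exact hi0

/-- The tail of length 1 is always closed (by the reversal of the last letter). [cite: MadrasSlade1993, Definition 1.2.4] -/
theorem exists_close7 (u : Word 8 d) : ∃ x : Idx d, bsumW u 7 8 + twoStepV d x = 0 := by
  refine ⟨revIdx (u ⟨7, by norm_num⟩), ?_⟩
  rw [bsumW_succ u le_rfl (by norm_num), bsumW_self, zero_add, twoStepV_revIdx, add_neg_cancel]

open Classical in
/-- ★ THE EXTENSION COUNT for a self-avoiding eight-letter word: the self-avoiding extensions, plus the reversal, plus one for each closable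
even tail, make up all `2d` letters. [cite: MadrasSlade1993, §1.2] -/
theorem card_ext_add8 (u : Word 8 d) (hu : SAW8 u) :
    (Finset.univ.filter fun x : Idx d => Percolation.IsSAW (Fin.snoc u x : Word 9 d)).card + 1 + (if TailClose 5 u then 1 else 0) +
      (if TailClose 3 u then 1 else 0) + (if TailClose 1 u then 1 else 0) = 2 * d := by
  classical
  set E7 := Finset.univ.filter fun x : Idx d => bsumW u 7 8 + twoStepV d x = 0 with hE7
  set E5 := Finset.univ.filter fun x : Idx d => bsumW u 5 8 + twoStepV d x = 0 with hE5
  set E3 := Finset.univ.filter fun x : Idx d => bsumW u 3 8 + twoStepV d x = 0 with hE3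
  set E1 := Finset.univ.filter fun x : Idx d => bsumW u 1 8 + twoStepV d x = 0 with hE1
  have c7 : E7.card = 1 := by rw [hE7, card_filter_close, if_pos (exists_close7 u)]
  have cT : ∀ (i : ℕ) (E : Finset (Idx d)), E = (Finset.univ.filter fun x : Idx d => bsumW u i 8 + twoStepV d x = 0) →
      E.card = if TailClose i u then 1 else 0 := by
    intro i E hE
    rw [hE, card_filter_close]
    exact if_congr (tailClose_iff_exists u i).symm rfl rfl
  have c5 := cT 5 E5 hE5
  have c3 := cT 3 E3 hE3
  have c1 := cT 1 E1 hE1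
  have hb := (saw8_iff_blocks u).1 hu
  -- pairwise disjoint
  have d75 : Disjoint E7 E5 := Finset.disjoint_filter.2 fun x _ h7 h5 => tail_ne_tail8 u (by norm_num) (hb 5 7 (by norm_num) (by norm_num)) x h5 h7
  have d73 : Disjoint E7 E3 := Finset.disjoint_filter.2 fun x _ h7 h3 => tail_ne_tail8 u (by norm_num) (hb 3 7 (by norm_num) (by norm_num)) x h3 h7
  have d71 : Disjoint E7 E1 := Finset.disjoint_filter.2 fun x _ h7 h1 => tail_ne_tail8 u (by norm_num) (hb 1 7 (by norm_num) (by norm_num)) x h1 h7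
  have d53 : Disjoint E5 E3 := Finset.disjoint_filter.2 fun x _ h5 h3 => tail_ne_tail8 u (by norm_num) (hb 3 5 (by norm_num) (by norm_num)) x h3 h5
  have d51 : Disjoint E5 E1 := Finset.disjoint_filter.2 fun x _ h5 h1 => tail_ne_tail8 u (by norm_num) (hb 1 5 (by norm_num) (by norm_num)) x h1 h5
  have d31 : Disjoint E3 E1 := Finset.disjoint_filter.2 fun x _ h3 h1 => tail_ne_tail8 u (by norm_num) (hb 1 3 (by norm_num) (by norm_num)) x h1 h3
  -- the good letters are the complement of the union
  have hgood : (Finset.univ.filter fun x : Idx d => Percolation.IsSAW (Fin.snoc u x : Word 9 d)) = Finset.univ \ (E7 ∪ E5 ∪ E3 ∪ E1) := by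
    ext x
    simp only [Finset.mem_filter, Finset.mem_univ, true_and, Finset.mem_sdiff, Finset.mem_union, hE7, hE5, hE3, hE1, not_or,
      isSAW_snoc_iff8]
    constructor
    · rintro ⟨-, t7, t5, t3, t1⟩; exact ⟨⟨⟨t7, t5⟩, t3⟩, t1⟩
    · rintro ⟨⟨⟨t7, t5⟩, t3⟩, t1⟩; exact ⟨hu, t7, t5, t3, t1⟩
  have hU : (E7 ∪ E5 ∪ E3 ∪ E1).card = E7.card + E5.card + E3.card + E1.card := by
    rw [Finset.card_union_of_disjoint, Finset.card_union_of_disjoint, Finset.card_union_of_disjoint d75]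
    · exact Finset.disjoint_union_left.2 ⟨d73, d53⟩
    · exact Finset.disjoint_union_left.2 ⟨Finset.disjoint_union_left.2 ⟨d71, d51⟩, d31⟩
  have hsub : (E7 ∪ E5 ∪ E3 ∪ E1) ⊆ Finset.univ := Finset.subset_univ _
  have := Finset.card_sdiff_add_card_eq_card hsub
  rw [← hgood, hU, c7, c5, c3, c1, Finset.card_univ, card_idx] at this
  omega

open Classical in
/-- A non-self-avoiding prefix has no self-avoiding extension. [cite: MadrasSlade1993, §1.2] -/
theorem card_ext_of_not8 (u : Word 8 d) (hu : ¬ SAW8 u) :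
    (Finset.univ.filter fun x : Idx d => Percolation.IsSAW (Fin.snoc u x : Word 9 d)).card = 0 := by
  rw [Finset.card_eq_zero, Finset.filter_eq_empty_iff]
  intro x _ hx
  exact hu ((isSAW_snoc_iff8 u x).1 hx).1

/-- Words of length 9 as (prefix, last letter). [cite: MadrasSlade1993, Definition 1.2.4] -/
def snocEquiv8 (d : ℕ) : Word 8 d × Idx d ≃ Word 9 d where
  toFun p := Fin.snoc p.1 p.2
  invFun w := (Fin.init w, w (Fin.last 8))
  left_inv p := by
    obtain ⟨u, x⟩ := p
    simp only [Fin.init_snoc, Fin.snoc_last]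
  right_inv w := Fin.snoc_init_self w

/-- ★★ **THE LAST-LETTER DECOMPOSITION AT LENGTH NINE**: `#sawWords d 9 + #SAW8 + #Sq + #Hx + #Oct = 2d · #SAW8`. [cite: MadrasSlade1993, §1.2] -/
theorem card_sawWords_nine_add (d : ℕ) :
    (Percolation.sawWords d 9).card + (Finset.univ.filter fun u : Word 8 d => SAW8 u).card +
      (Finset.univ.filter fun u : Word 8 d => SAW8 u ∧ TailClose 5 u).card +
      (Finset.univ.filter fun u : Word 8 d => SAW8 u ∧ TailClose 3 u).card +
      (Finset.univ.filter fun u : Word 8 d => SAW8 u ∧ TailClose 1 u).card =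
      2 * d * (Finset.univ.filter fun u : Word 8 d => SAW8 u).card := by
  classical
  set S := Finset.univ.filter fun u : Word 8 d => SAW8 u with hS
  have e1 : (Percolation.sawWords d 9).card = (Finset.univ.filter fun w : Word 9 d => Percolation.IsSAW w).card := by
    unfold Percolation.sawWords
    congr 1
  have h9 : (Percolation.sawWords d 9).card =
      ∑ u ∈ S, (Finset.univ.filter fun x : Idx d => Percolation.IsSAW (Fin.snoc u x : Word 9 d)).card := by
    rw [e1, card_filter_univ_equiv (snocEquiv8 d)]
    simp only [snocEquiv8, Equiv.coe_fn_mk]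
    rw [Finset.card_filter, Fintype.sum_prod_type]
    dsimp only
    symm
    refine (Finset.sum_congr rfl fun u _ => Finset.card_filter _ _).trans ?_
    exact Finset.sum_subset (Finset.subset_univ S) fun u _ hu => by
      have hu' : ¬ SAW8 u := fun h => hu (Finset.mem_filter.2 ⟨Finset.mem_univ _, h⟩)
      rw [← Finset.card_filter]
      exact card_ext_of_not8 u hu'
  have hq : ∀ (q : Word 8 d → Prop) [DecidablePred q],
      (Finset.univ.filter fun u : Word 8 d => SAW8 u ∧ q u).card = ∑ u ∈ S, if q u then 1 else 0 := by
    intro q _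
    rw [← Finset.card_filter, hS, Finset.filter_filter]
  have h1 : S.card = ∑ u ∈ S, 1 := by simp
  rw [h9, hq (TailClose 5), hq (TailClose 3), hq (TailClose 1), h1, ← Finset.sum_add_distrib, ← Finset.sum_add_distrib,
    ← Finset.sum_add_distrib, ← Finset.sum_add_distrib]
  rw [show 2 * d * ∑ u ∈ S, 1 = ∑ u ∈ S, 2 * d by rw [Finset.mul_sum, mul_one]]
  refine Finset.sum_congr rfl fun u hu => ?_
  exact card_ext_add8 u (Finset.mem_filter.1 hu).2

/-- The class `SAW8` counts the eight-step self-avoiding walks: `#{u : Word 8 d | SAW8 u} = count d 8`. [cite: MadrasSlade1993, §1.2] -/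
theorem card_filter_saw8_eq_count (d : ℕ) : (Finset.univ.filter fun u : Word 8 d => SAW8 u).card = count d 8 := by
  classical
  rw [← card_sawWords_eq_count]
  congr 1
  ext u
  simp only [Finset.mem_filter, Finset.mem_univ, true_and, Percolation.mem_sawWords, isSAW_iff_saw8]

/-- ★★ **`c₉(ℤ^d)` assembled** (subtraction-free, mixed form): `count d 9 + count d 8 + SQ9 + HX9 + OCT9 = 2d · count d 8` with the three closer
censuses in falling factorials. [cite: MadrasSlade1993, Appendix C, Table C.1] -/
theorem count_nine_add_descFactorial (d : ℕ) :
    count d 9 + count d 8 +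
      (496 * d.descFactorial 2 + 8152 * d.descFactorial 3 + 18192 * d.descFactorial 4 + 10944 * d.descFactorial 5 +
        2176 * d.descFactorial 6 + 128 * d.descFactorial 7) +
      (156 * d.descFactorial 2 + 3528 * d.descFactorial 3 + 6464 * d.descFactorial 4 + 2624 * d.descFactorial 5 + 256 * d.descFactorial 6) +
      (88 * d.descFactorial 2 + 1904 * d.descFactorial 3 + 3456 * d.descFactorial 4 + 864 * d.descFactorial 5) = 2 * d * count d 8 := by
  have h := card_sawWords_nine_add d
  rw [card_sawWords_eq_count, card_filter_saw8_eq_count, card_sq8, card_hx8, card_oct8] at h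
  exact h

/-- ★★★ **`c₉(ℤ^d) + 2048d⁸ + 1600d⁶ + 15376d³ + 5858d = 512d⁹ + 2816d⁷ + 704d⁵ + 4096d⁴ + 16756d²`** for every `d` (subtraction-free closed form).
[cite: MadrasSlade1993, Appendix C, Table C.1] -/
theorem count_nine_add (d : ℕ) :
    count d 9 + 2048 * d ^ 8 + 1600 * d ^ 6 + 15376 * d ^ 3 + 5858 * d =
      512 * d ^ 9 + 2816 * d ^ 7 + 704 * d ^ 5 + 4096 * d ^ 4 + 16756 * d ^ 2 := by
  have h := count_nine_add_descFactorial d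
  have h8 := count_eight_add d
  generalize count d 9 = N at h ⊢
  generalize count d 8 = M at h h8
  rcases Nat.lt_or_ge d 7 with hd | hd
  · interval_cases d <;> simp only [Nat.descFactorial] at h <;> omega
  · obtain ⟨e, rfl⟩ := Nat.exists_eq_add_of_le' hd
    simp only [Nat.descFactorial_succ, Nat.descFactorial_zero, mul_one] at h
    have hM : (M : ℤ) = 256 * (e + 7) ^ 8 + 1024 * (e + 7) ^ 6 + 320 * (e + 7) ^ 4 + 424 * (e + 7) ^ 3 + 1414 * (e + 7) -
        896 * (e + 7) ^ 7 - 416 * (e + 7) ^ 5 - 2124 * (e + 7) ^ 2 := by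
      have := congrArg (fun m : ℕ => (m : ℤ)) h8
      push_cast at this
      linarith
    have hZ := congrArg (fun m : ℕ => (m : ℤ)) h
    push_cast at hZ ⊢
    rw [hM] at hZ
    nlinarith [hZ]

/-- ★★★ **`c₉(ℤ^d) = 512d⁹ − 2048d⁸ + 2816d⁷ − 1600d⁶ + 704d⁵ + 4096d⁴ − 15376d³ + 16756d² − 5858d`** (natural subtraction, exact by `count_nine_add`).
[cite: MadrasSlade1993, Appendix C, Table C.1] -/
theorem count_nine (d : ℕ) :
    count d 9 = 512 * d ^ 9 + 2816 * d ^ 7 + 704 * d ^ 5 + 4096 * d ^ 4 + 16756 * d ^ 2 - 2048 * d ^ 8 - 1600 * d ^ 6 -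
      15376 * d ^ 3 - 5858 * d := by
  have h := count_nine_add d
  omega

/-- ★★★ **The cost-nine irreducible bridges of length ten**: `N_{9,10}(ℤ^{d+1}) + 2048d⁸ + 1600d⁶ + 15376d³ + 5858d = 512d⁹ + 2816d⁷ + 704d⁵ + 4096d⁴ + 16756d²`.
[cite: MadrasSlade1993, §4.2, remark after Theorem 4.2.4 (p. 94)] -/
theorem costCoeffZd_nine_ten_add (d : ℕ) :
    costCoeffZd d 9 10 + 2048 * d ^ 8 + 1600 * d ^ 6 + 15376 * d ^ 3 + 5858 * d =
      512 * d ^ 9 + 2816 * d ^ 7 + 704 * d ^ 5 + 4096 * d ^ 4 + 16756 * d ^ 2 := by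
  rw [costCoeffZd_self_succ]
  exact count_nine_add d

/-- ★★★ **`N_{9,10}(ℤ^{d+1}) = c₉(ℤ^d)`** in closed form (natural subtraction). [cite: MadrasSlade1993, §4.2, remark after Theorem 4.2.4 (p. 94)] -/
theorem costCoeffZd_nine_ten (d : ℕ) :
    costCoeffZd d 9 10 = 512 * d ^ 9 + 2816 * d ^ 7 + 704 * d ^ 5 + 4096 * d ^ 4 + 16756 * d ^ 2 - 2048 * d ^ 8 - 1600 * d ^ 6 -
      15376 * d ^ 3 - 5858 * d := by
  rw [costCoeffZd_self_succ]
  exact count_nine d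

/-- Lane value `d = 1`: `c₉(ℤ¹) = 2`. [cite: MadrasSlade1993, §1.2] -/
theorem count_nine_one : count 1 9 = 2 := by
  have h := count_nine_add 1
  generalize count 1 9 = N at h ⊢
  norm_num at h
  omega

/-- Lane value `d = 2`: `c₉(ℤ²) = 16 268` (locator: Table C.1). [cite: MadrasSlade1993, Appendix C, Table C.1] -/
theorem count_nine_two : count 2 9 = 16268 := by
  have h := count_nine_add 2
  generalize count 2 9 = N at h ⊢
  norm_num at h
  omega

/-- Lane value `d = 3`: `c₉(ℤ³) = 1 853 886` (locator: Table C.1). [cite: MadrasSlade1993, Appendix C, Table C.1] -/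
theorem count_nine_three : count 3 9 = 1853886 := by
  have h := count_nine_add 3
  generalize count 3 9 = N at h ⊢
  norm_num at h
  omega

end tenstep

end WordTypes

end Literature.Probability.RandomPlanarGeometry.SAW.Zd
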